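import Mathlib.Topology.Algebra.Group.Basic
import Mathlib.RepresentationTheory.Basic
import Literature.NumberTheory.GaloisRepresentations.LocalField
import Literature.NumberTheory.GaloisRepresentations.AbsGaloisGroup
import Literature.NumberTheory.GaloisRepresentations.LocalGaloisGroup
import HarnessLib

-- provenance: harness21/H21/H21/Prelude/GalRep/WeilGroup.lean @ 4335363 (interim HEAD d8f2665); M5 mechanical rewrite
/-!
# The Weil group of a non-archimedean local field (trunk GalRep, item C7; notion `weil_group`)

Let `F` be a non-archimedean local field (`[IsNonarchimedeanLocalField F]`, Mathlib), with
absolute Galois group `Γ_F = Field.absoluteGaloisGroup F`, inertia group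
`I_F = Literature.absInertia F` and residue cardinality `q = q_F = residueFieldCard F` (items C1, C4).
The *Weil group* `W_F ⊆ Γ_F` is the subgroup of those `σ` which act on the residue field
`𝔽̄_q` of `F̄` as an *integral* power of the Frobenius `x ↦ x ^ q`, i.e.
`W_F = {σ | ∃ n : ℤ, IsFrobPow σ n}`; it sits in `1 → I_F → W_F → ℤ → 0` and is topologised by
declaring `I_F` (with its profinite topology) to be open
(Tate, *Number theoretic background*, Corvallis 1979, (1.4.1)–(1.4.6); Deligne, *Les constantes
des équations fonctionnelles des fonctions L*, Antwerp II (1973), §2.2).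

## Contents

* `Literature.weilSubgroup F : Subgroup Γ_F` and `mem_weilSubgroup_iff`.
* `Literature.WeilGroup F` (a type wrapper, `def`, so that the subspace topology of `Γ_F` is *not*
  inherited), its `Group` instance, the injection `WeilGroup.toAbsGalois : W_F →* Γ_F`, the
  inertia subgroup `WeilGroup.inertia`, the degree `WeilGroup.deg : W_F → ℤ` and the norm
  `WeilGroup.norm w = q ^ deg w`.
* Functoriality `WeilGroup.map : W_E →* W_F` for an extension `E/F` (`deg` is multiplied by the
  residue degree, `deg_map`).
* The Weil topology (`WeilGroup.instTopologicalSpace`) and its basic properties: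
  `isOpen_inertia` is proved; `continuous_toAbsGalois`, `isTopologicalGroup`,
  `denseRange_toAbsGalois`, `isCompact_inertia`, `isEmbedding_toAbsGalois_restrict_inertia`,
  `continuous_deg`, `continuous_map` (and `weilSubgroup_map_absGaloisRestrict_le`) are **named
  facts** (Tate (1.4.1), (1.4.6)).
* The continuity criterion for representations on discrete spaces used downstream (C8, C10,
  C18): `WeilGroup.IsContinuousRep ρ` (open kernel on inertia) and `WeilGroup.IsUnramifiedRep ρ`.

## Sign convention (OUTLINE §1; cross-referenced by WeilDeligneRep, ArtinConductor,
LocalClassFieldTheory)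

`IsFrobPow σ 1` means `σ` is an *arithmetic* Frobenius (`x ↦ x ^ q mod 𝔓`), so
`deg (arithmetic Frobenius) = +1`, `‖arith Frob‖ = norm _ = q`, and a *geometric* Frobenius
(Deligne) has `deg = -1`, `‖geom Frob‖ = q⁻¹`.  Tate (Corvallis 1979, (1.4.1)–(1.4.6)) normalises
`‖w‖` so that `‖w‖ = |Art⁻¹ w|_F`, i.e. a geometric Frobenius (image of a uniformiser) has norm
`q⁻¹`; this agrees with `WeilGroup.norm`.  The `‖w‖` of statement lang.S11 is this `norm`.

## Mathlib search

Mathlib (this pin) has `Field.absoluteGaloisGroup`, `IsArithFrobAt`, `Ideal.inertia`,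
`Subgroup.closure`, `TopologicalSpace.generateFrom`, `Representation`, but no Weil group of a
local field (`rg Weil` only hits measure theory / descent files).  Nothing here duplicates a
Mathlib declaration.

## Design choices

* `WeilGroup F` is a `def` (not `abbrev`) equal to `↥(weilSubgroup F)`; the `Group` structure is
  transported by `inferInstanceAs`, the topology is *new* (outline D6).
* `WeilGroup.deg` is defined by `Exists.choose` with junk value `0` off the (in fact empty)
  complement of `{w | ∃ n, IsFrobPow w n}`; `mem_weilSubgroup_iff` (proved) shows the junk branch
  is never taken, and `IsFrobPow.unique` (C4) shows the choice is irrelevant.  The named facts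
  `IsFrobPow.mul`, `IsFrobPow.unique`, `exists_isFrobPow`, `absInertia_normal`,
  `IsFrobPow.absGaloisRestrict`, `absInertia_map_absGaloisRestrict_le` of `LocalGaloisGroup` are
  threaded as explicit hypotheses (`hmul`, `huniq`, `hex`, …) where used; `degHom` takes
  `hmul huniq`, and `inertia_normal` is a theorem (hypothesis `absInertia_normal F`).

## Downstream note (M5 migration)

Signature changes importers must absorb (their migrate items are blocked/claimed on this file;
intended pattern: **thread the named facts explicitly**, do not quantify them inside statements):
* `mem_weilSubgroup_iff`, `exists_isFrobPow_toAbsGalois`, `isFrobPow_deg` take `hmul`;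
  `deg_eq_iff`, `deg_one/mul/inv`, `norm_one/mul/inv`, `deg_eq_zero_iff_mem_inertia`,
  `norm_eq_one_iff_mem_inertia` take `hmul huniq`; `deg_surjective` takes `hmul huniq hex`;
  `deg_map`/`norm_map` take the `F`- and `E`-facts and `IsFrobPow.absGaloisRestrict`;
  `map_inertia_le` takes `absInertia_map_absGaloisRestrict_le`; `degHom F hmul huniq` is a
  hypothesis-taking definition; `inertia_normal` is a theorem, no longer an instance.
* `WeilDeligneRep` (:267 `deg_inv`; :368 `inertia_normal` as instance; :389–394 the geometric
  Frobenius chosen via `deg_surjective` INSIDE A DEFINITION): the prepared migration threads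
  `hmul huniq` into `dual`, `hn : absInertia_normal F` into `restrictInertiaInvariantsKerN` /
  `eulerFactor` / `lFactor`, and defines `geomFrob F hex := WeilGroup.mk (choose (hex (-1))) …`
  from `hex : exists_isFrobPow` (a deliberate *thread* choice — no junk fallback), with
  `deg_geomFrob hmul huniq hex`; hence every Euler factor / local `L`-factor built on it carries
  `hn hex`.
* `LocalConstants` (:259, :269 — `norm_mul`, `norm_eq_one_iff_mem_inertia`), `LParameter` (:309 —
  `continuous_toAbsGalois`, now a fact), `LocalGalois` (:93–120 — the `lang.S11` wrappers of the
  density/continuity facts, `deg_surjective`, `degHom`, `deg_eq_zero_iff_mem_inertia`),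
  `ArtinConductor`, `DualGroup`, `HeckeCharacter` (via `ArtinLFunction`): same threading.
The mathematics is unchanged; all of these hypotheses disappear once the four `LocalGaloisGroup`
facts are discharged.
* `WeilGroup.map` takes the inclusion `res(W_E) ≤ W_F` as an explicit hypothesis so that the
  definition is `sorry`-free; `weilSubgroup_map_absGaloisRestrict_le` supplies it for finite
  `E/F` with compatible valuations.
* `IsTopologicalGroup (WeilGroup F)` is a theorem, not an instance (outline D6): downstream only
  uses `→*` and the predicate `IsContinuousRep`.
-/

noncomputable section

open scoped Valued
open ValuativeRel Field

namespace Literature.NumberTheory.GaloisRepresentations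

open GaloisRepresentations.IsNonarchimedeanLocalField

section WeilSubgroup

variable (F : Type*) [Field F] [ValuativeRel F] [TopologicalSpace F] [IsNonarchimedeanLocalField F]

/-- The Weil group of `F` as a subgroup of `Γ_F = Gal(F̄/F)`: the subgroup generated by (in fact
equal to, `mem_weilSubgroup_iff`) the set of `σ` acting on the residue field of `F̄` as an
integral power of the `q`-Frobenius, `{σ | ∃ n : ℤ, IsFrobPow σ n}`.
Ref: Tate, *Number theoretic background* (Corvallis 1979), (1.4.1). [cite: Corvallis1979] -/
def weilSubgroup : Subgroup (absoluteGaloisGroup F) :=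
  Subgroup.closure {σ | ∃ n : ℤ, IsFrobPow σ n}

variable {F}

/-- `σ ∈ W_F ↔ ∃ n, IsFrobPow σ n`: the generating set of `weilSubgroup F` is already a subgroup
(`IsFrobPow.one`, `IsFrobPow.mul` — the hypothesis `hmul` —, `IsFrobPow.inv`).
Ref: Tate, *Number theoretic background* (Corvallis 1979), (1.4.1). [cite: Corvallis1979] -/
theorem mem_weilSubgroup_iff (hmul : IsFrobPow.mul (F := F)) {σ : absoluteGaloisGroup F} :
    σ ∈ weilSubgroup F ↔ ∃ n : ℤ, IsFrobPow σ n := by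
  refine ⟨fun h => ?_, fun h => Subgroup.subset_closure h⟩
  induction h using Subgroup.closure_induction with
  | mem x hx => exact hx
  | one => exact ⟨0, IsFrobPow.one⟩
  | mul x y _ _ hx hy =>
    obtain ⟨m, hm⟩ := hx
    obtain ⟨n, hn⟩ := hy
    exact ⟨m + n, hmul hm hn⟩
  | inv x _ hx =>
    obtain ⟨n, hn⟩ := hx
    exact ⟨-n, hn.inv⟩

/-- Frobenius powers lie in `W_F` (the generating set; no hypotheses).
Ref: Tate, *Number theoretic background* (Corvallis 1979), (1.4.1). [cite: Corvallis1979, (1.4.1)] -/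
theorem mem_weilSubgroup_of_isFrobPow {σ : absoluteGaloisGroup F} {n : ℤ} (h : IsFrobPow σ n) :
    σ ∈ weilSubgroup F :=
  Subgroup.subset_closure ⟨n, h⟩

variable (F)

/-- `I_F ≤ W_F`: inertia elements are Frobenius powers of exponent `0`.
Ref: Tate, *Number theoretic background* (Corvallis 1979), (1.4.1). [cite: Corvallis1979] -/
theorem absInertia_le_weilSubgroup : absInertia F ≤ weilSubgroup F := fun _ hσ =>
  mem_weilSubgroup_of_isFrobPow (isFrobPow_zero_iff_mem_absInertia.mpr hσ)

end WeilSubgroup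

/-! ### The Weil group as a type -/

/-- The *Weil group* `W_F` of a non-archimedean local field `F`, as a type: the elements of
`Gal(F̄/F)` inducing an integral power of Frobenius on the residue field.  This is a `def`
wrapping `↥(weilSubgroup F)` so that the (wrong) subspace topology from `Gal(F̄/F)` is not
inherited; the Weil topology is `WeilGroup.instTopologicalSpace`.
Ref: Tate, *Number theoretic background* (Corvallis 1979), (1.4.1); Deligne, *Les constantes des
équations fonctionnelles* (1973), §2.2.4. [cite: Corvallis1979] -/
def WeilGroup (F : Type*) [Field F] [ValuativeRel F] [TopologicalSpace F]
    [IsNonarchimedeanLocalField F] : Type _ :=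
  ↥(weilSubgroup F)

namespace WeilGroup

section Basic

variable (F : Type*) [Field F] [ValuativeRel F] [TopologicalSpace F] [IsNonarchimedeanLocalField F]

/-- The group structure on `W_F`, transported from the subgroup `weilSubgroup F ≤ Gal(F̄/F)`.
Ref: Tate, *Number theoretic background* (Corvallis 1979), (1.4.1). [cite: Corvallis1979] -/
instance instGroup : Group (WeilGroup F) :=
  inferInstanceAs <| Group ↥(weilSubgroup F)

/-- The inclusion `W_F →* Gal(F̄/F)` (injective with dense image).
Ref: Tate, *Number theoretic background* (Corvallis 1979), (1.4.1). [cite: Corvallis1979] -/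
def toAbsGalois : WeilGroup F →* absoluteGaloisGroup F :=
  (weilSubgroup F).subtype

variable {F}

/-- Build an element of `W_F` from `σ ∈ Gal(F̄/F)` and a proof that it is a Frobenius power.
Ref: Tate, *Number theoretic background* (Corvallis 1979), (1.4.1). [cite: Corvallis1979] -/
def mk (σ : absoluteGaloisGroup F) (h : ∃ n : ℤ, IsFrobPow σ n) : WeilGroup F :=
  ⟨σ, Subgroup.subset_closure h⟩

/-- `toAbsGalois (mk σ h) = σ`.  Ref: Tate, Corvallis 1979, (1.4.1). [cite: Corvallis1979, (1.4.1] -/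
@[simp]
theorem toAbsGalois_mk (σ : absoluteGaloisGroup F) (h : ∃ n : ℤ, IsFrobPow σ n) :
    toAbsGalois F (mk σ h) = σ :=
  rfl

/-- `toAbsGalois` is the subtype coercion.  Ref: Tate, Corvallis 1979, (1.4.1). [cite: Corvallis1979, (1.4.1] -/
theorem toAbsGalois_apply (w : WeilGroup F) :
    toAbsGalois F w = ((show ↥(weilSubgroup F) from w) : absoluteGaloisGroup F) :=
  rfl

/-- `W_F → Gal(F̄/F)` is injective.  Ref: Tate, Corvallis 1979, (1.4.1). [cite: Corvallis1979, (1.4.1] -/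
theorem toAbsGalois_injective : Function.Injective (toAbsGalois F) :=
  (weilSubgroup F).subtype_injective

/-- `toAbsGalois w = toAbsGalois w' ↔ w = w'`.  Ref: Tate, Corvallis 1979, (1.4.1). [cite: Corvallis1979, (1.4.1] -/
@[simp]
theorem toAbsGalois_inj {w w' : WeilGroup F} : toAbsGalois F w = toAbsGalois F w' ↔ w = w' :=
  toAbsGalois_injective.eq_iff

/-- The image of `W_F → Gal(F̄/F)` is `weilSubgroup F`.  Ref: Tate, Corvallis 1979, (1.4.1). [cite: Corvallis1979, (1.4.1] -/
@[simp]
theorem range_toAbsGalois : (toAbsGalois F).range = weilSubgroup F :=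
  (weilSubgroup F).range_subtype

/-- Every element of `W_F` is a Frobenius power of some (unique) integral exponent (given
multiplicativity of Frobenius powers, `hmul`).
Ref: Tate, *Number theoretic background* (Corvallis 1979), (1.4.1). [cite: Corvallis1979] -/
theorem exists_isFrobPow_toAbsGalois (hmul : IsFrobPow.mul (F := F)) (w : WeilGroup F) :
    ∃ n : ℤ, IsFrobPow (toAbsGalois F w) n :=
  (mem_weilSubgroup_iff hmul).mp (show ↥(weilSubgroup F) from w).2

variable (F)

/-- The inertia subgroup `I_F ≤ W_F`: the preimage of `absInertia F ≤ Gal(F̄/F)` (all of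
`I_F` lies in `W_F`, `absInertia_le_weilSubgroup`).
Ref: Tate, *Number theoretic background* (Corvallis 1979), (1.4.1). [cite: Corvallis1979] -/
def inertia : Subgroup (WeilGroup F) :=
  (absInertia F).comap (toAbsGalois F)

variable {F}

/-- Membership in `WeilGroup.inertia`.  Ref: Tate, Corvallis 1979, (1.4.1). [cite: Corvallis1979, (1.4.1] -/
@[simp]
theorem mem_inertia_iff {w : WeilGroup F} : w ∈ inertia F ↔ toAbsGalois F w ∈ absInertia F :=
  Iff.rfl

/-- `toAbsGalois` maps `WeilGroup.inertia F` onto `absInertia F`.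
Ref: Tate, *Number theoretic background* (Corvallis 1979), (1.4.1). [cite: Corvallis1979] -/
theorem inertia_map_toAbsGalois : (inertia F).map (toAbsGalois F) = absInertia F := by
  refine Subgroup.map_comap_eq_self ?_
  rw [range_toAbsGalois]
  exact absInertia_le_weilSubgroup F

/-- `I_F` is normal in `W_F`, given normality of `I_F ≤ Gal(F̄/F)` (`absInertia_normal`, the
hypothesis `h`; a theorem rather than an instance for that reason).
Ref: Tate, Corvallis 1979, (1.4.1). [cite: Corvallis1979, (1.4.1] -/
theorem inertia_normal (h : absInertia_normal F) : (inertia F).Normal :=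
  haveI : (absInertia F).Normal := h
  Subgroup.Normal.comap inferInstance _

end Basic

/-! ### Degree and norm -/

section Deg

variable {F : Type*} [Field F] [ValuativeRel F] [TopologicalSpace F] [IsNonarchimedeanLocalField F]

open scoped Classical in
/-- The *degree* `deg : W_F → ℤ`: `deg w = n` iff `w` acts on the residue field of `F̄` as the
`n`-th power of the arithmetic Frobenius `x ↦ x ^ q` (so `deg (arith Frob) = +1`,
`deg (geom Frob) = -1`, `deg = 0` on inertia; sign convention of the module docstring).
Defined as `h.choose` for `h : ∃ n, IsFrobPow (toAbsGalois w) n`, with junk value `0` in the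
`else` branch — which is never taken (`exists_isFrobPow_toAbsGalois`); the exponent is unique by
`IsFrobPow.unique`.  Tate writes `w ↦ q ^ deg w = ‖w‖`.  The lemmas below take the named facts
`IsFrobPow.mul` (`hmul`) and `IsFrobPow.unique` (`huniq`) of `LocalGaloisGroup` as hypotheses.
Ref: Tate, *Number theoretic background* (Corvallis 1979), (1.4.1)–(1.4.4). [cite: Corvallis1979] -/
def deg (w : WeilGroup F) : ℤ :=
  if h : ∃ n : ℤ, IsFrobPow (toAbsGalois F w) n then h.choose else 0

/-- Characterisation of `deg`: `w` is a Frobenius power of exponent `deg w`.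
Ref: Tate, *Number theoretic background* (Corvallis 1979), (1.4.1). [cite: Corvallis1979] -/
theorem isFrobPow_deg (hmul : IsFrobPow.mul (F := F)) (w : WeilGroup F) :
    IsFrobPow (toAbsGalois F w) (deg w) := by
  rw [deg, dif_pos (exists_isFrobPow_toAbsGalois hmul w)]
  exact (exists_isFrobPow_toAbsGalois hmul w).choose_spec

/-- `deg w = n ↔ IsFrobPow w n` (uniqueness of the exponent, `IsFrobPow.unique`).
Ref: Tate, *Number theoretic background* (Corvallis 1979), (1.4.1). [cite: Corvallis1979] -/
theorem deg_eq_iff (hmul : IsFrobPow.mul (F := F)) (huniq : IsFrobPow.unique (F := F))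
    {w : WeilGroup F} {n : ℤ} : deg w = n ↔ IsFrobPow (toAbsGalois F w) n :=
  ⟨fun h => h ▸ isFrobPow_deg hmul w, fun h => huniq (isFrobPow_deg hmul w) h⟩

/-- `deg 1 = 0`.  Ref: Tate, Corvallis 1979, (1.4.1). [cite: Corvallis1979, (1.4.1] -/
@[simp]
theorem deg_one (hmul : IsFrobPow.mul (F := F)) (huniq : IsFrobPow.unique (F := F)) :
    deg (1 : WeilGroup F) = 0 :=
  (deg_eq_iff hmul huniq).mpr (by simpa using (IsFrobPow.one (F := F)))

/-- `deg` is a homomorphism: `deg (w * w') = deg w + deg w'`.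
Ref: Tate, *Number theoretic background* (Corvallis 1979), (1.4.1). [cite: Corvallis1979] -/
@[simp]
theorem deg_mul (hmul : IsFrobPow.mul (F := F)) (huniq : IsFrobPow.unique (F := F))
    (w w' : WeilGroup F) : deg (w * w') = deg w + deg w' :=
  (deg_eq_iff hmul huniq).mpr (by simpa using hmul (isFrobPow_deg hmul w) (isFrobPow_deg hmul w'))

/-- `deg w⁻¹ = - deg w`.  Ref: Tate, Corvallis 1979, (1.4.1). [cite: Corvallis1979, (1.4.1] -/
@[simp]
theorem deg_inv (hmul : IsFrobPow.mul (F := F)) (huniq : IsFrobPow.unique (F := F))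
    (w : WeilGroup F) : deg w⁻¹ = -deg w :=
  (deg_eq_iff hmul huniq).mpr (by simpa using (isFrobPow_deg hmul w).inv)

variable (F) in
/-- The degree as a group homomorphism `W_F →* Multiplicative ℤ` (given the facts `hmul`,
`huniq` making `deg` a homomorphism).
Ref: Tate, *Number theoretic background* (Corvallis 1979), (1.4.1). [cite: Corvallis1979] -/
def degHom (hmul : IsFrobPow.mul (F := F)) (huniq : IsFrobPow.unique (F := F)) :
    WeilGroup F →* Multiplicative ℤ where
  toFun w := Multiplicative.ofAdd (deg w)
  map_one' := by simp [deg_one hmul huniq]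
  map_mul' w w' := by simp [deg_mul hmul huniq, ofAdd_add]

/-- Unfolding lemma for `degHom`.  Ref: Tate, Corvallis 1979, (1.4.1). [cite: Corvallis1979, (1.4.1] -/
@[simp]
theorem degHom_apply (hmul : IsFrobPow.mul (F := F)) (huniq : IsFrobPow.unique (F := F))
    (w : WeilGroup F) : degHom F hmul huniq w = Multiplicative.ofAdd (deg w) := rfl

/-- `deg w = 0 ↔ w ∈ I_F`: the kernel of `deg` is the inertia group, i.e. the sequence
`1 → I_F → W_F → ℤ` is exact.
Ref: Tate, *Number theoretic background* (Corvallis 1979), (1.4.1). [cite: Corvallis1979] -/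
theorem deg_eq_zero_iff_mem_inertia (hmul : IsFrobPow.mul (F := F))
    (huniq : IsFrobPow.unique (F := F)) {w : WeilGroup F} : deg w = 0 ↔ w ∈ inertia F := by
  rw [deg_eq_iff hmul huniq, isFrobPow_zero_iff_mem_absInertia, mem_inertia_iff]

/-- `deg : W_F → ℤ` is surjective (an arithmetic Frobenius has degree `1`), i.e.
`1 → I_F → W_F → ℤ → 0` is exact.
Ref: Tate, *Number theoretic background* (Corvallis 1979), (1.4.1)–(1.4.4). [cite: Corvallis1979] -/
theorem deg_surjective (hmul : IsFrobPow.mul (F := F)) (huniq : IsFrobPow.unique (F := F))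
    (hex : exists_isFrobPow (F := F)) : Function.Surjective (deg (F := F)) := fun n => by
  obtain ⟨σ, hσ⟩ := hex n
  exact ⟨mk σ ⟨n, hσ⟩, (deg_eq_iff hmul huniq).mpr hσ⟩

/-- The *norm* (or *module*) `‖w‖ = q ^ deg w ∈ ℝ` of `w ∈ W_F`, `q = residueFieldCard F`.
**Sign convention** (OUTLINE §1, cross-referenced by `WeilDeligneRep`, `ArtinConductor`,
`LocalClassFieldTheory`): `deg` counts the *arithmetic* Frobenius as `+1`, so
`‖arith Frob‖ = q` and `‖geom Frob‖ = q⁻¹`; under the local Artin map (uniformiser ↦ geometric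
Frobenius) `‖w‖ = |Art⁻¹ w|_F`.  This is the `‖w‖` of Tate, *Number theoretic background*
(Corvallis 1979), (1.4.1)–(1.4.6), and of statement lang.S11. [cite: Corvallis1979] -/
def norm (w : WeilGroup F) : ℝ :=
  (residueFieldCard F : ℝ) ^ deg w

/-- Unfolding lemma for `WeilGroup.norm`.  Ref: Tate, Corvallis 1979, (1.4.1). [cite: Corvallis1979, (1.4.1] -/
theorem norm_def (w : WeilGroup F) : norm w = (residueFieldCard F : ℝ) ^ deg w := rfl

/-- `‖w‖ > 0`.  Ref: Tate, Corvallis 1979, (1.4.1). [cite: Corvallis1979, (1.4.1] -/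
theorem norm_pos (w : WeilGroup F) : 0 < norm w :=
  zpow_pos (by exact_mod_cast Nat.pos_of_ne_zero (residueFieldCard_ne_zero F)) _

/-- `‖1‖ = 1`.  Ref: Tate, Corvallis 1979, (1.4.1). [cite: Corvallis1979, (1.4.1] -/
@[simp]
theorem norm_one (hmul : IsFrobPow.mul (F := F)) (huniq : IsFrobPow.unique (F := F)) :
    norm (1 : WeilGroup F) = 1 := by
  simp [norm, deg_one hmul huniq]

/-- `‖w w'‖ = ‖w‖ ‖w'‖`.  Ref: Tate, Corvallis 1979, (1.4.1). [cite: Corvallis1979, (1.4.1] -/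
@[simp]
theorem norm_mul (hmul : IsFrobPow.mul (F := F)) (huniq : IsFrobPow.unique (F := F))
    (w w' : WeilGroup F) : norm (w * w') = norm w * norm w' := by
  rw [norm, deg_mul hmul huniq, zpow_add₀ (by exact_mod_cast residueFieldCard_ne_zero F)]
  rfl

/-- `‖w⁻¹‖ = ‖w‖⁻¹`.  Ref: Tate, Corvallis 1979, (1.4.1). [cite: Corvallis1979, (1.4.1] -/
@[simp]
theorem norm_inv (hmul : IsFrobPow.mul (F := F)) (huniq : IsFrobPow.unique (F := F))
    (w : WeilGroup F) : norm w⁻¹ = (norm w)⁻¹ := by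
  rw [norm, deg_inv hmul huniq, zpow_neg]
  rfl

/-- `‖w‖ = 1 ↔ w ∈ I_F`.  Ref: Tate, Corvallis 1979, (1.4.1). [cite: Corvallis1979, (1.4.1] -/
theorem norm_eq_one_iff_mem_inertia (hmul : IsFrobPow.mul (F := F))
    (huniq : IsFrobPow.unique (F := F)) {w : WeilGroup F} : norm w = 1 ↔ w ∈ inertia F := by
  rw [← deg_eq_zero_iff_mem_inertia hmul huniq, norm]
  have h1 : (1 : ℝ) < residueFieldCard F := by exact_mod_cast one_lt_residueFieldCard F
  exact zpow_right_injective₀ (zero_lt_one.trans h1) h1.ne' |>.eq_iff' (zpow_zero _)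

end Deg

/-! ### Functoriality in finite extensions -/

section Map

variable (F E : Type*) [Field F] [ValuativeRel F] [TopologicalSpace F]
  [IsNonarchimedeanLocalField F] [Field E] [ValuativeRel E] [TopologicalSpace E]
  [IsNonarchimedeanLocalField E] [Algebra F E]

/-- Functoriality of the Weil group: for an extension `E/F` of non-archimedean local fields such
that the restriction `res : Gal(Ē/E) → Gal(F̄/F)` (`Literature.absGaloisRestrict F E`) maps `W_E` into
`W_F` (hypothesis `h`, supplied for finite `E/F` by `weilSubgroup_map_absGaloisRestrict_le`), the
induced homomorphism `W_E →* W_F`.  The inclusion is an explicit hypothesis so that this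
definition is `sorry`-free.  Both fields are explicit: one writes `WeilGroup.map F E h`.
Ref: Tate, *Number theoretic background* (Corvallis 1979), (1.4.5)–(1.4.6). [cite: Corvallis1979] -/
def map (h : (weilSubgroup E).map (absGaloisRestrict F E).toMonoidHom ≤ weilSubgroup F) :
    WeilGroup E →* WeilGroup F :=
  ((absGaloisRestrict F E).toMonoidHom.comp (toAbsGalois E)).codRestrict (weilSubgroup F)
    fun w => h ⟨toAbsGalois E w, (show ↥(weilSubgroup E) from w).2, rfl⟩

variable {F E} in
/-- `WeilGroup.map` is compatible with the inclusions into the absolute Galois groups.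
Ref: Tate, *Number theoretic background* (Corvallis 1979), (1.4.6). [cite: Corvallis1979] -/
@[simp]
theorem toAbsGalois_map
    (h : (weilSubgroup E).map (absGaloisRestrict F E).toMonoidHom ≤ weilSubgroup F)
    (w : WeilGroup E) :
    toAbsGalois F (map F E h w) = absGaloisRestrict F E (toAbsGalois E w) :=
  rfl

variable {F E} in
/-- `WeilGroup.map` is injective when `E/F` is algebraic.
Ref: Tate, *Number theoretic background* (Corvallis 1979), (1.4.6). [cite: Corvallis1979] -/
theorem map_injective [Algebra.IsAlgebraic F E]
    (h : (weilSubgroup E).map (absGaloisRestrict F E).toMonoidHom ≤ weilSubgroup F) :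
    Function.Injective (map F E h) := fun w w' hw => by
  apply toAbsGalois_injective
  apply absGaloisRestrict_injective F E
  simpa only [toAbsGalois_map] using congr(toAbsGalois F $hw)

/-- For a finite extension `E/F` of non-archimedean local fields with compatible valuations
(explicit binders: a `def … : Prop` does not pick up unused section instances), the
restriction `Gal(Ē/E) → Gal(F̄/F)` maps `W_E` into `W_F` (a Frobenius power of exponent `n`
for `E` restricts to one of exponent `f n` for `F`, `f` the residue degree;
`IsFrobPow.absGaloisRestrict`).  This fact also carries the existence of the residue degree
`f` with `q_E = q_F ^ f` for finite `E/F` with compatible valuations (Serre, *Local Fields*, Ch. II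
§2), which the C1/C4 API currently takes as an explicit argument.
Ref: Tate, *Number theoretic background* (Corvallis 1979), (1.4.5)–(1.4.6). [cite: Corvallis1979] -/
def weilSubgroup_map_absGaloisRestrict_le [FiniteDimensional F E] [ValuativeExtension F E] : Prop :=
  (weilSubgroup E).map (absGaloisRestrict F E).toMonoidHom ≤ weilSubgroup F

variable {F E}

/-- Degree scaling: `deg_F (map w) = f * deg_E w`, where `f` is the residue degree of `E/F`
(`q_E = q_F ^ f`).  Equivalently `‖map w‖_F = ‖w‖_E` (Tate's normalisation is compatible with
restriction).  Hypotheses: the facts `IsFrobPow.mul`/`IsFrobPow.unique` for `F` and `E` and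
`IsFrobPow.absGaloisRestrict` (`hres`).
Ref: Tate, *Number theoretic background* (Corvallis 1979), (1.4.5)–(1.4.6). [cite: Corvallis1979] -/
theorem deg_map (hmulF : IsFrobPow.mul (F := F)) (huniqF : IsFrobPow.unique (F := F))
    (hmulE : IsFrobPow.mul (F := E)) (hres : IsFrobPow.absGaloisRestrict F (E := E))
    (h : (weilSubgroup E).map (absGaloisRestrict F E).toMonoidHom ≤ weilSubgroup F)
    (f : ℕ) (hf : residueFieldCard E = residueFieldCard F ^ f) (w : WeilGroup E) :
    deg (map F E h w) = f * deg w :=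
  (deg_eq_iff hmulF huniqF).mpr (hres (isFrobPow_deg hmulE w) f hf)

/-- Norm compatibility: `‖map w‖_F = ‖w‖_E`.
Ref: Tate, *Number theoretic background* (Corvallis 1979), (1.4.6). [cite: Corvallis1979] -/
theorem norm_map (hmulF : IsFrobPow.mul (F := F)) (huniqF : IsFrobPow.unique (F := F))
    (hmulE : IsFrobPow.mul (F := E)) (hres : IsFrobPow.absGaloisRestrict F (E := E))
    (h : (weilSubgroup E).map (absGaloisRestrict F E).toMonoidHom ≤ weilSubgroup F)
    (f : ℕ) (hf : residueFieldCard E = residueFieldCard F ^ f) (w : WeilGroup E) :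
    norm (map F E h w) = norm w := by
  rw [norm, norm, deg_map hmulF huniqF hmulE hres h f hf, zpow_mul, hf]
  norm_cast

/-- `WeilGroup.map` sends `I_E` into `I_F` (`absInertia_map_absGaloisRestrict_le`, the hypothesis
`hI`).  Ref: Serre, *Local Fields*, Ch. I §7, Prop. 22; Tate, Corvallis 1979, (1.4.5). [cite: Corvallis1979, (1.4.5] -/
theorem map_inertia_le (hI : absInertia_map_absGaloisRestrict_le F E)
    (h : (weilSubgroup E).map (absGaloisRestrict F E).toMonoidHom ≤ weilSubgroup F) :
    (inertia E).map (map F E h) ≤ inertia F := by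
  rintro _ ⟨w, hw, rfl⟩
  rw [mem_inertia_iff, toAbsGalois_map]
  exact hI ⟨_, hw, rfl⟩

end Map

/-! ### The Weil topology -/

section Topology

variable (F : Type*) [Field F] [ValuativeRel F] [TopologicalSpace F] [IsNonarchimedeanLocalField F]

/-- The *Weil topology* on `W_F`: generated by the sets `{x | x w⁻¹ ∈ I_F, x ∈ V}` for
`w ∈ W_F` and `V ⊆ Gal(F̄/F)` open, i.e. the translates of (Krull-)open subsets of `I_F`.  Thus
`I_F` is open in `W_F` and carries its profinite subspace topology from `Gal(F̄/F)`, and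
`W_F / I_F ≅ ℤ` is discrete.  This is *not* the subspace topology from `Gal(F̄/F)` (outline D6).
Ref: Tate, *Number theoretic background* (Corvallis 1979), (1.4.1); Deligne, *Les constantes des
équations fonctionnelles* (1973), §2.2.4. [cite: Corvallis1979] -/
instance instTopologicalSpace : TopologicalSpace (WeilGroup F) :=
  TopologicalSpace.generateFrom
    {U | ∃ (w : WeilGroup F) (V : Set (absoluteGaloisGroup F)),
      IsOpen V ∧ U = {x | x * w⁻¹ ∈ inertia F ∧ toAbsGalois F x ∈ V}}

/-- `I_F` is open in `W_F`.  Ref: Tate, *Number theoretic background* (Corvallis 1979), (1.4.1). [cite: Corvallis1979] -/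
theorem isOpen_inertia : IsOpen (inertia F : Set (WeilGroup F)) := by
  refine TopologicalSpace.isOpen_generateFrom_of_mem ⟨1, Set.univ, isOpen_univ, ?_⟩
  ext x
  simp

/-- The inclusion `W_F → Gal(F̄/F)` is continuous (the Weil topology is finer than the subspace
topology).  Ref: Tate, *Number theoretic background* (Corvallis 1979), (1.4.1). [cite: Corvallis1979] -/
def continuous_toAbsGalois : Prop :=
  Continuous (toAbsGalois F)

/-- `W_F` with the Weil topology is a topological group.  Stated as a theorem, not an instance
(outline D6).  Ref: Tate, *Number theoretic background* (Corvallis 1979), (1.4.1). [cite: Corvallis1979] -/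
def isTopologicalGroup : Prop :=
  IsTopologicalGroup (WeilGroup F)

/-- `W_F` is dense in `Gal(F̄/F)` (it contains a Frobenius, which topologically generates
`Gal(F̄/F) / I_F ≅ Ẑ`).  Ref: Tate, *Number theoretic background* (Corvallis 1979), (1.4.1). [cite: Corvallis1979] -/
def denseRange_toAbsGalois : Prop :=
  DenseRange (toAbsGalois F)

/-- `I_F ⊆ W_F` is compact: on `I_F` the Weil topology is the profinite (Krull) topology and
`I_F` is closed in `Gal(F̄/F)`.
Ref: Tate, *Number theoretic background* (Corvallis 1979), (1.4.1). [cite: Corvallis1979] -/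
def isCompact_inertia : Prop :=
  IsCompact (inertia F : Set (WeilGroup F))

/-- On `I_F` the Weil topology agrees with the Krull topology: `toAbsGalois` restricted to `I_F`
is an embedding.  Ref: Tate, *Number theoretic background* (Corvallis 1979), (1.4.1). [cite: Corvallis1979] -/
def isEmbedding_toAbsGalois_restrict_inertia : Prop :=
  Topology.IsEmbedding ((inertia F : Set (WeilGroup F)).restrict (toAbsGalois F))

/-- `deg : W_F → ℤ` is continuous for the discrete topology on `ℤ` (its kernel `I_F` is open).
Ref: Tate, *Number theoretic background* (Corvallis 1979), (1.4.1). [cite: Corvallis1979] -/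
def continuous_deg : Prop :=
  Continuous (deg (F := F))

/-- For a finite extension `E/F` of non-archimedean local fields with compatible valuations,
`WeilGroup.map : W_E → W_F` is continuous for the Weil topologies (it sends the open profinite
subgroup `I_E` into `I_F`, `map_inertia_le`, continuously for the Krull topologies).
Ref: Tate, *Number theoretic background* (Corvallis 1979), (1.4.6). [cite: Corvallis1979] -/
def continuous_map (E : Type*) [Field E] [ValuativeRel E] [TopologicalSpace E]
    [IsNonarchimedeanLocalField E] [Algebra F E] [FiniteDimensional F E] [ValuativeExtension F E] :
    Prop :=
  ∀ (h : (weilSubgroup E).map (absGaloisRestrict F E).toMonoidHom ≤ weilSubgroup F),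
    Continuous (map F E h)

end Topology

/-! ### Continuity of representations on discrete spaces -/

section Rep

variable {F : Type*} [Field F] [ValuativeRel F] [TopologicalSpace F] [IsNonarchimedeanLocalField F]
variable {C V : Type*} [CommSemiring C] [AddCommMonoid V] [Module C V]

/-- Continuity of a representation `ρ` of `W_F` on a *discrete* `C`-module `V` (the notion used
for Weil–Deligne representations): `ρ` is trivial on some open subgroup `U ≤ I_F` of `W_F`.  For
finite-dimensional `V` this is equivalent to continuity of `ρ : W_F → GL(V)` for the discrete
topology on `GL(V)`, and (over `ℂ`) for the usual topology.
Ref: Tate, *Number theoretic background* (Corvallis 1979), (1.4.1), (4.1.2); Deligne, *Les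
constantes des équations fonctionnelles* (1973), §8.3. [cite: Corvallis1979] -/
def IsContinuousRep (ρ : Representation C (WeilGroup F) V) : Prop :=
  ∃ U : Subgroup (WeilGroup F), U ≤ inertia F ∧ IsOpen (U : Set (WeilGroup F)) ∧ ∀ u ∈ U, ρ u = 1

/-- A representation `ρ` of `W_F` is *unramified* if it is trivial on the inertia group `I_F`.
Ref: Tate, *Number theoretic background* (Corvallis 1979), (1.4.1), (4.1.6). [cite: Corvallis1979] -/
def IsUnramifiedRep (ρ : Representation C (WeilGroup F) V) : Prop :=
  ∀ u ∈ inertia F, ρ u = 1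

/-- An unramified representation is continuous (take `U = I_F`, open by `isOpen_inertia`).
Ref: Tate, *Number theoretic background* (Corvallis 1979), (4.1.6). [cite: Corvallis1979] -/
theorem IsUnramifiedRep.isContinuousRep {ρ : Representation C (WeilGroup F) V}
    (h : IsUnramifiedRep ρ) : IsContinuousRep ρ :=
  ⟨inertia F, le_rfl, isOpen_inertia F, h⟩

/-- The trivial representation of `W_F` is unramified.
Ref: Tate, *Number theoretic background* (Corvallis 1979), (4.1.6). [cite: Corvallis1979] -/
theorem isUnramifiedRep_trivial : IsUnramifiedRep (Representation.trivial C (WeilGroup F) V) :=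
  fun _ _ => rfl

/-- The trivial representation of `W_F` is continuous.
Ref: Tate, *Number theoretic background* (Corvallis 1979), (4.1.2). [cite: Corvallis1979] -/
theorem isContinuousRep_trivial : IsContinuousRep (Representation.trivial C (WeilGroup F) V) :=
  isUnramifiedRep_trivial.isContinuousRep

end Rep

end WeilGroup

end Literature.NumberTheory.GaloisRepresentations
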